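import Summits.ResolutionOfSingularities.ResolutionOfSingularities.Theorems.FrobeniusLadderFInjectiveMacaulayficationNewtonChartLemmaRegularWeak
import HarnessLib

/-!
# GAP-2 «k ≠ k̄»: the row engine's per-chart clause `hon'` for WEAKLY non-degenerate `f` over ANY field of characteristic `p` (geometric weak non-degeneracy)
# (crux `FInjectiveMacaulayfication` stmt-ResolutionOfSingularities-15315, chain w45a; seat res-L1-w45a-stub-2 g12; any-field twin of res-L1-w45a-stub-3's
# ✓ `NewtonChartLemma.{isRegularLocalRing_of_chart_weak, fullCl_of_chart_weak, hon_of_weaklyNondegenerate}` (`…NewtonChartLemmaRegularWeak`) with the ONE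
# `k = k̄` step — the Nullstellensatz point of a maximal ideal — replaced by a GEOMETRIC point over an algebraically closed extension `K ⊇ k`)

[OURS · L1 W4.5a] Support file (`--supports stmt-ResolutionOfSingularities-15315 --as helper`); def-free; UNCONDITIONAL; no named fact; NOT a statement of any manuscript;
replaces the role of NO printed item. AI-written (AI review is weaker than expert review). Nothing of the crux is proved here.

THE POINT. The registered F-half stub `LocalFullificationFibreAdmGe4Split.LocalFInjectivizationFibreAdmGe4` quantifies over EVERY field `k` of characteristic `p`; the class
theorems of record (`F108ClassRowUnconditional.pointFloorRow_of_convenient` ✓ and every census `…RowClass/…RowUncond`) assume `[IsAlgClosed k]`. In the whole chain the closure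
is used at exactly one place: `NewtonChartLemma.hon_of_weaklyNondegenerate` picks, for a MAXIMAL ideal `Q` of the chart ring `k[Y]/(g_c)`, a `k`-rational point `y` with
`Q = ker (eval y)` and runs Ishii's Lemma 4.4.24 (`ishii_lemma_4_4_24_weak`) at `y`. Over an arbitrary field a maximal ideal is the ideal of a GEOMETRIC point
`y ∈ Kᵐ`, `K ⊇ k` algebraically closed (Mathlib's `MvPolynomial.eq_vanishingIdeal_singleton_of_isMaximal`: `Q = {h | aeval y h = 0}`); Ishii's lemma, run over `K` on
`map f` / `map g_c` at `y`, yields a partial derivative `∂ᵢ g_c` with `aeval y (∂ᵢ g_c) ≠ 0`, i.e. `∂ᵢ g_c ∉ Q`, and `HypersurfaceRegular.stub_hypersurfaceRegularOfPderiv`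
(field-general) gives regularity. The price is the honest one: `IsWeaklyNondegenerateAlong w f` quantifies over `k`-RATIONAL torus points, so the hypothesis becomes GEOMETRIC weak
non-degeneracy — weak non-degeneracy of `map (algebraMap k K) f` along every positive weight (for the census beds the Specimen lemmas `weaklyNondegenerate (k) [Field k] [CharP k p]`
hold over every field, in particular over `K`).
* §1 `aeval_theta_X`, `sum_row_pos_of_aeval_theta_X` (the orbit of a geometric point at which every `θ_V(X_j)` vanishes lies over the origin), `map_theta` (chart identities
  survive `map`);
* §2 ★ `isRegularLocalRing_of_chart_geom`, ★ `fullCl_of_chart_geom` — at every prime `Q` of `k[Y]/(g)` which is the ideal of a geometric point `y ∈ Kᵐ` over the origin, the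
  strict transform of a geometrically weakly non-degenerate hypersurface is REGULAR, hence `FullCl p`;
* §3 ★★ `hon_of_geomWeaklyNondegenerate` — the `hon'` binder of `CICertificates.ciCertificates(_of_isPrime)` (`J := univ`, `r := 1`, `Fs := ![f]`, `gs c := ![g_c]`) VERBATIM,
  for ANY field `k` of characteristic `p`, `K ⊇ k` algebraically closed, `map (algebraMap k K) f` weakly non-degenerate along every positive weight.
[cite: IshiiSingularities2018, Lemma 4.4.24 (pp. 96–97)] [cite: Matsumura1987, Thm. 5.3 and Thm. 30.4] [cite: BoubakriGreuelMarkwig2010, §3 (p. 10)]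
-/

-- single-problem summit: the doubled namespace component is forced
set_option linter.dupNamespace false

noncomputable section

open MvPolynomial

namespace Summit.ResolutionOfSingularities.ResolutionOfSingularities.Theorems.FInjectiveMacaulayfication.NewtonChartHonAnyField

open Summit.ResolutionOfSingularities.ResolutionOfSingularities.Theorems.FInjectiveMacaulayfication
open Literature.AlgebraicGeometry.Resolution Literature.AlgebraicGeometry.Resolution.BoubakriGreuelMarkwig SliceableCentre

variable {k : Type} [Field k] (K : Type) [Field K] [Algebra k K] {m : ℕ}

/-! ## §1 Plumbing: geometric points and `map` -/

variable (k) in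
/-- `aeval y (∏ᵢ Yᵢ^{V i j}) = ∏ᵢ yᵢ^{V i j}`. [plumbing] -/
theorem aeval_theta_X (V : Matrix (Fin m) (Fin m) ℕ) (y : Fin m → K) (j : Fin m) :
    aeval y (∏ i : Fin m, (X i : MvPolynomial (Fin m) k) ^ V i j) = ∏ i : Fin m, y i ^ V i j := by
  rw [map_prod]
  refine Finset.prod_congr rfl fun i _ => ?_
  rw [map_pow, aeval_X]

variable (k) in
/-- If every `θ_V(X_j) = ∏ᵢ Yᵢ^{V i j}` vanishes at the GEOMETRIC point `y ∈ Kᵐ`, then the weight `Σ_{i : yᵢ = 0} row i` is strictly positive: the orbit of `y` lies over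
the origin. (Any-field twin of `NewtonChartLemma.sum_row_pos_of_theta_X_mem`.) [plumbing] -/
theorem sum_row_pos_of_aeval_theta_X (V : Matrix (Fin m) (Fin m) ℕ) (y : Fin m → K) (S : Finset (Fin m)) (hy : ∀ i, y i = 0 ↔ i ∈ S)
    (h : ∀ j : Fin m, aeval y (∏ i : Fin m, (X i : MvPolynomial (Fin m) k) ^ V i j) = 0) (j : Fin m) : 0 < ∑ i ∈ S, V i j := by
  have hj := h j
  rw [aeval_theta_X k K] at hj
  obtain ⟨i, -, hi⟩ := Finset.prod_eq_zero_iff.mp hj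
  obtain ⟨hyi, hne⟩ := pow_eq_zero_iff'.mp hi
  exact lt_of_lt_of_le (Nat.pos_of_ne_zero hne) (Finset.single_le_sum (fun i _ => Nat.zero_le (V i j)) ((hy i).mp hyi))

omit [Algebra k K] in
/-- The chart identity `θ_V f = Y^e · g` survives extension of scalars: `θ_V (map φ f) = Y^e · map φ g`. [plumbing] -/
theorem map_theta (φ : k →+* K) (f : MvPolynomial (Fin m) k) (V : Matrix (Fin m) (Fin m) ℕ) (e : Fin m →₀ ℕ) (g : MvPolynomial (Fin m) k)
    (hθ : aeval (fun j : Fin m => ∏ i : Fin m, (X i : MvPolynomial (Fin m) k) ^ V i j) f = monomial e 1 * g) :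
    aeval (fun j : Fin m => ∏ i : Fin m, (X i : MvPolynomial (Fin m) K) ^ V i j) (map φ f) = monomial e 1 * map φ g := by
  have h := congrArg (map φ) hθ
  rw [map_mul, map_monomial, map_one, aeval_eq_bind₁, map_bind₁] at h
  have hfun : (fun j : Fin m => map φ (∏ i : Fin m, (X i : MvPolynomial (Fin m) k) ^ V i j)) =
      fun j : Fin m => ∏ i : Fin m, (X i : MvPolynomial (Fin m) K) ^ V i j := by
    funext j
    rw [map_prod]
    refine Finset.prod_congr rfl fun i _ => ?_
    rw [map_pow, map_X]
  rw [hfun] at h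
  rw [aeval_eq_bind₁]
  exact h

/-! ## §2 ★ Regular, hence FULL, over the origin — at geometric points -/

/-- ★ **REGULARITY OF THE STRICT TRANSFORM OVER THE ORIGIN AT A GEOMETRIC POINT, ANY FIELD.** `k` any field, `K ⊇ k` a field; `f ∈ k[Y]` with `map (algebraMap k K) f`
weakly non-degenerate along every positive weight; `V` unimodular with `θ_V f = Y^e · g`, `g(0) ≠ 0`; `y ∈ Kᵐ` a geometric point of the orbit `{yᵢ = 0 ⟺ i ∈ S}` over the
origin; `Q` a prime of `k[Y]/(g)` which IS the ideal of `y` (`h ∈ Q ⟺ aeval y h = 0`). Then `(k[Y]/(g))_Q` is REGULAR: Ishii's Lemma 4.4.24 over `K` at `y` for `map f`, `map g`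
gives `aeval y (∂ᵢ g) ≠ 0` (`pderiv_map`), i.e. `∂ᵢ g ∉ Q`, and `HypersurfaceRegular.stub_hypersurfaceRegularOfPderiv` concludes.
[cite: IshiiSingularities2018, Lemma 4.4.24 (pp. 96–97)] [cite: Matsumura1987, Thm. 30.4] -/
theorem isRegularLocalRing_of_chart_geom (f : MvPolynomial (Fin m) k)
    (hWND : ∀ w : Fin m → ℝ, (∀ i, 0 < w i) →
      IsWeaklyNondegenerateAlong w ((map (algebraMap k K) f : MvPolynomial (Fin m) K) : MvPowerSeries (Fin m) K))
    (V : Matrix (Fin m) (Fin m) ℕ) (hV : IsUnit (V.map (Nat.cast : ℕ → ℤ)).det)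
    (e : Fin m →₀ ℕ) (g : MvPolynomial (Fin m) k) (hθ : aeval (fun j : Fin m => ∏ i : Fin m, (X i : MvPolynomial (Fin m) k) ^ V i j) f = monomial e 1 * g)
    (hg0 : constantCoeff g ≠ 0) (S : Finset (Fin m)) (hpos : ∀ j : Fin m, 0 < ∑ i ∈ S, V i j) (y : Fin m → K) (hy : ∀ i : Fin m, y i = 0 ↔ i ∈ S)
    (Q : Ideal (MvPolynomial (Fin m) k ⧸ Ideal.span {g})) [Q.IsPrime]
    (hQ : ∀ h : MvPolynomial (Fin m) k, h ∈ Q.comap (Ideal.Quotient.mk (Ideal.span {g})) ↔ aeval y h = 0) :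
    IsRegularLocalRing (Localization.AtPrime Q) := by
  have hgQ : g ∈ Q.comap (Ideal.Quotient.mk (Ideal.span {g})) := by
    rw [Ideal.mem_comap, Ideal.Quotient.eq_zero_iff_mem.mpr (Ideal.mem_span_singleton_self g)]
    exact Q.zero_mem
  -- Ishii over `K` at the geometric point `y`
  have hgy : MvPolynomial.eval y (map (algebraMap k K) g) = 0 := by
    rw [eval_map, ← aeval_def]
    exact (hQ g).mp hgQ
  have hg0' : constantCoeff (map (algebraMap k K) g) ≠ 0 := by
    rw [constantCoeff_map]
    exact fun h0 => hg0 ((algebraMap k K).injective (by rw [h0, map_zero]))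
  obtain ⟨i, -, hi⟩ := NewtonChartLemma.ishii_lemma_4_4_24_weak (map (algebraMap k K) f) hWND V hV e (map (algebraMap k K) g)
    (map_theta K (algebraMap k K) f V e g hθ) hg0' S hpos y hy hgy
  refine HypersurfaceRegular.stub_hypersurfaceRegularOfPderiv k m g i Q fun hmem => hi ?_
  rw [pderiv_map, eval_map, ← aeval_def]
  exact (hQ _).mp hmem

/-- ★ **… HENCE FULL** (any field): in characteristic `p`, at every such prime the local ring of the strict transform is `FullCl p` — regular local rings are FULL
(`FTemkinClosedPoints.fullCl_of_isRegularLocalRing`). [OURS · unconditional; cite: IshiiSingularities2018, Lemma 4.4.24; Matsumura1987, Thm. 30.4] -/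
theorem fullCl_of_chart_geom (p : ℕ) [Fact p.Prime] [CharP k p] (f : MvPolynomial (Fin m) k)
    (hWND : ∀ w : Fin m → ℝ, (∀ i, 0 < w i) →
      IsWeaklyNondegenerateAlong w ((map (algebraMap k K) f : MvPolynomial (Fin m) K) : MvPowerSeries (Fin m) K))
    (V : Matrix (Fin m) (Fin m) ℕ) (hV : IsUnit (V.map (Nat.cast : ℕ → ℤ)).det)
    (e : Fin m →₀ ℕ) (g : MvPolynomial (Fin m) k) (hθ : aeval (fun j : Fin m => ∏ i : Fin m, (X i : MvPolynomial (Fin m) k) ^ V i j) f = monomial e 1 * g)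
    (hg0 : constantCoeff g ≠ 0) (S : Finset (Fin m)) (hpos : ∀ j : Fin m, 0 < ∑ i ∈ S, V i j) (y : Fin m → K) (hy : ∀ i : Fin m, y i = 0 ↔ i ∈ S)
    (Q : Ideal (MvPolynomial (Fin m) k ⧸ Ideal.span {g})) [Q.IsPrime]
    (hQ : ∀ h : MvPolynomial (Fin m) k, h ∈ Q.comap (Ideal.Quotient.mk (Ideal.span {g})) ↔ aeval y h = 0) :
    FullCl p (Localization.AtPrime Q) := by
  haveI := isRegularLocalRing_of_chart_geom K f hWND V hV e g hθ hg0 S hpos y hy Q hQ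
  haveI : Nontrivial (MvPolynomial (Fin m) k ⧸ Ideal.span {g}) :=
    nontrivial_of_ne (1 : MvPolynomial (Fin m) k ⧸ Ideal.span {g}) 0 fun h10 =>
      Ideal.IsPrime.ne_top ‹_› ((Ideal.eq_top_iff_one Q).mpr (by rw [h10]; exact Q.zero_mem))
  haveI : CharP (MvPolynomial (Fin m) k ⧸ Ideal.span {g}) p :=
    charP_of_injective_algebraMap (algebraMap k (MvPolynomial (Fin m) k ⧸ Ideal.span {g})).injective p
  haveI : CharP (Localization.AtPrime Q) p := DegreeZeroDescent.charP_localization_atPrime p Q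
  exact FTemkinClosedPoints.fullCl_of_isRegularLocalRing p _

/-! ## §3 ★★ The engine's per-chart clause from GEOMETRIC weak non-degeneracy, any field -/

set_option maxHeartbeats 800000 in
-- the clause binder block is large; one Nullstellensatz (geometric) point, one transport along `quotEquivOfEq`, one `fullCl_of_chart_geom`
/-- ★★ **`hon'` FOR THE WEAKLY NON-DEGENERATE CLASS OVER ANY FIELD OF CHARACTERISTIC `p`.** `k` ANY field of characteristic `p`, `K ⊇ k` algebraically closed;
`f ∈ k[X]` with `map (algebraMap k K) f` weakly non-degenerate along every positive weight (GEOMETRIC weak non-degeneracy); unimodular charts `V_c` refining the dual Newton fan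
(`θ_{V_c} f = Y^{d_c}·g_c`, `g_c(0) ≠ 0`). Then for every chart `c` and every MAXIMAL ideal `Q'` of `k[Y]/(g_c)` over the origin: (i) each variable `Y_i ∈ Q'` is a
non-zero-divisor modulo `g_c` locally, and (ii) `(k[Y]/(g_c))_{Q'}` carries the CM + Frobenius-closed clause (it is REGULAR). This is the binder `hon'` of
`CICertificates.ciCertificates` / `ciCertificates_of_isPrime` with `J := univ`, `r := 1`, `Fs := ![f]`, `gs c := ![g_c]`, VERBATIM — the `[IsAlgClosed k]` of
`NewtonChartLemma.hon_of_weaklyNondegenerate` removed: the maximal ideal `Q'` is the ideal of a GEOMETRIC point `y ∈ Kᵐ` (`MvPolynomial.eq_vanishingIdeal_singleton_of_isMaximal`).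
[cite: IshiiSingularities2018, Lemma 4.4.24] [cite: Matsumura1987, Thm. 5.3] -/
theorem hon_of_geomWeaklyNondegenerate (p : ℕ) [Fact p.Prime] [CharP k p] [IsAlgClosed K] (f : MvPolynomial (Fin m) k)
    (hWND : ∀ w : Fin m → ℝ, (∀ i, 0 < w i) →
      IsWeaklyNondegenerateAlong w ((map (algebraMap k K) f : MvPolynomial (Fin m) K) : MvPowerSeries (Fin m) K))
    (t : ℕ) (V : Fin t → Matrix (Fin m) (Fin m) ℕ)
    (hV : ∀ c, IsUnit ((V c).map (Nat.cast : ℕ → ℤ)).det) (g : Fin t → MvPolynomial (Fin m) k) (d : Fin t → (Fin m →₀ ℕ))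
    (hθ : ∀ c, aeval (fun j : Fin m => ∏ i : Fin m, (X i : MvPolynomial (Fin m) k) ^ V c i j) f = monomial (d c) 1 * g c)
    (hg0 : ∀ c, constantCoeff (g c) ≠ 0) :
    ∀ (c : Fin t) (Q' : Ideal (MvPolynomial (Fin m) k ⧸ Ideal.span (Set.range (![g c] : Fin 1 → MvPolynomial (Fin m) k)))) [Q'.IsMaximal],
      (∀ j ∈ (Finset.univ : Finset (Fin m)), Ideal.Quotient.mk (Ideal.span (Set.range (![g c] : Fin 1 → MvPolynomial (Fin m) k)))
        (aeval (fun j : Fin m => ∏ i : Fin m, (X i : MvPolynomial (Fin m) k) ^ V c i j) (X j : MvPolynomial (Fin m) k)) ∈ Q') →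
        (∀ i : Fin m, (X i : MvPolynomial (Fin m) k) ∈ Q'.comap (Ideal.Quotient.mk (Ideal.span (Set.range (![g c] : Fin 1 → MvPolynomial (Fin m) k)))) →
          IsSMulRegular (Localization.AtPrime (Q'.comap (Ideal.Quotient.mk (Ideal.span (Set.range (![g c] : Fin 1 → MvPolynomial (Fin m) k))))) ⧸
              (Ideal.span (Set.range (![g c] : Fin 1 → MvPolynomial (Fin m) k))).map (algebraMap (MvPolynomial (Fin m) k)
                (Localization.AtPrime (Q'.comap (Ideal.Quotient.mk (Ideal.span (Set.range (![g c] : Fin 1 → MvPolynomial (Fin m) k))))))))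
            (algebraMap (MvPolynomial (Fin m) k)
              (Localization.AtPrime (Q'.comap (Ideal.Quotient.mk (Ideal.span (Set.range (![g c] : Fin 1 → MvPolynomial (Fin m) k)))))) (X i))) ∧
        ∀ dd : ℕ, ringKrullDim (Localization.AtPrime Q') = dd → ∀ s : Fin dd → Localization.AtPrime Q',
          (Ideal.span (Set.range s)).radical.IsMaximal →
            RingTheory.Sequence.IsWeaklyRegular (Localization.AtPrime Q') (List.ofFn s) ∧
            ∀ y : Localization.AtPrime Q', (∃ e : ℕ, y ^ p ^ e ∈ Ideal.span
              ((fun z : Localization.AtPrime Q' => z ^ p ^ e) ''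
                (Ideal.span (Set.range s) : Set (Localization.AtPrime Q')))) → y ∈ Ideal.span (Set.range s) := by
  classical
  intro c Q' _ hover
  have hI : Ideal.span {g c} = Ideal.span (Set.range (![g c] : Fin 1 → MvPolynomial (Fin m) k)) := (NewtonChartLemma.span_range_vec_one (g c)).symm
  -- the GEOMETRIC point `y ∈ Kᵐ` of the maximal ideal `Q'` (Nullstellensatz over an arbitrary field) and its zero pattern `S`
  haveI hQmax : (Q'.comap (Ideal.Quotient.mk (Ideal.span (Set.range (![g c] : Fin 1 → MvPolynomial (Fin m) k))))).IsMaximal :=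
    Ideal.comap_isMaximal_of_surjective _ Ideal.Quotient.mk_surjective
  obtain ⟨y, hy⟩ := MvPolynomial.eq_vanishingIdeal_singleton_of_isMaximal K hQmax
  have hmem : ∀ h : MvPolynomial (Fin m) k,
      h ∈ Q'.comap (Ideal.Quotient.mk (Ideal.span (Set.range (![g c] : Fin 1 → MvPolynomial (Fin m) k)))) ↔ aeval y h = 0 := fun h => by
    rw [hy, MvPolynomial.mem_vanishingIdeal_singleton_iff]
  set S : Finset (Fin m) := Finset.univ.filter fun i => y i = 0 with hS
  have hyS : ∀ i, y i = 0 ↔ i ∈ S := fun i => by simp [hS]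
  -- the orbit of `y` lies over the origin
  have hpos : ∀ j : Fin m, 0 < ∑ i ∈ S, V c i j := by
    refine sum_row_pos_of_aeval_theta_X k K (V c) y S hyS (fun j => ?_)
    have h1 : aeval (fun j : Fin m => ∏ i : Fin m, (X i : MvPolynomial (Fin m) k) ^ V c i j) (X j : MvPolynomial (Fin m) k) ∈
        Q'.comap (Ideal.Quotient.mk (Ideal.span (Set.range (![g c] : Fin 1 → MvPolynomial (Fin m) k)))) := hover j (Finset.mem_univ j)
    rw [aeval_X, hmem] at h1
    exact h1
  refine ⟨fun i _ => ?_, ?_⟩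
  · -- (i) `Y_i` is a non-zero-divisor modulo `g_c`, locally (field-general)
    exact KLocCell.isSMulRegular_localization_quotient_of_prime_not_dvd _ (MvPolynomial.X_prime (i := i))
      (NewtonChartLemma.not_X_dvd_of_constantCoeff_ne_zero (g c) (hg0 c) i) _ (NewtonChartLemma.span_range_vec_one (g c))
  · -- (ii) the clause: transport `fullCl_of_chart_geom` along `k[Y]/(g_c) ≃ k[Y]/(Set.range ![g_c])`
    let e : (MvPolynomial (Fin m) k ⧸ Ideal.span {g c}) ≃+* (MvPolynomial (Fin m) k ⧸ Ideal.span (Set.range (![g c] : Fin 1 → MvPolynomial (Fin m) k))) :=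
      Ideal.quotEquivOfEq hI
    haveI : (Q'.comap e.toRingHom).IsPrime := Ideal.comap_isPrime _ _
    have hQe : (Q'.comap e.toRingHom).comap (Ideal.Quotient.mk (Ideal.span {g c})) =
        Q'.comap (Ideal.Quotient.mk (Ideal.span (Set.range (![g c] : Fin 1 → MvPolynomial (Fin m) k)))) := by
      rw [Ideal.comap_comap]
      congr 1
    have hQ : ∀ h : MvPolynomial (Fin m) k, h ∈ (Q'.comap e.toRingHom).comap (Ideal.Quotient.mk (Ideal.span {g c})) ↔ aeval y h = 0 := fun h => by
      rw [hQe, hmem]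
    have hfull : FullCl p (Localization.AtPrime (Q'.comap e.toRingHom)) :=
      fullCl_of_chart_geom K p f hWND (V c) (hV c) (d c) (g c) (hθ c) (hg0 c) S hpos y hyS _ hQ
    exact (LocalBlowupBadFibreFromCharts.fullCl_localization_of_ringEquiv p e _ Q' rfl hfull).2

end Summit.ResolutionOfSingularities.ResolutionOfSingularities.Theorems.FInjectiveMacaulayfication.NewtonChartHonAnyField

end
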